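import Mathlib
import Summits.MatrixMultiplication.MatrixMultiplication.Theorems.SnSubsetDichotomyNoThresholdSubsetTriplePlancherelStepDefs

/-!
# The exact mass factor of one Plancherel growth step (route `SnSubsetDichotomy`, crux `NoThresholdSubsetTriple`)

Stub `transProb_insert_of_ne` ((F3) of the lead-c7 report, app. A) of line
`klr-graded-polynomial-method` (stmt-MatrixMultiplication-8302).

For a Young diagram `ν` (a finite lower set of cells `(row, col)`, componentwise order) and two
DISTINCT addable nodes `y ≠ z` of `ν`, adding the corner `z` multiplies the Plancherel transition
probability of `y` (hook-product form `PlancherelStep.transProb`) by exactly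

  `(h + 1)² / (h (h + 2)) = 1 + 1 / (h (h + 2))`,  `h = |row y − row z| + |col y − col z| − 1 ≥ 1`.

Proof: at an addable node `(a, b)` of a lower set the row `a` has length `b` and the column `b` has
length `a` (`rowLen_eq_of_addable`, `colLen_eq_of_addable`), so two distinct addable nodes lie
strictly north-east / south-west of each other; inserting `z = (r, c)` lengthens row `r` and
column `c` by one and nothing else, so among the hooks `h(a, j)`, `j < b`, and `h(i, b)`, `i < a`,
entering `p_y` exactly one changes — the hook of the cell in the row of one corner and the column
of the other — and it grows from `h` to `h + 1`; the factor is `((h+1)/(h+2)) / (h/(h+1))`.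
-/

open scoped BigOperators
open Literature.RepresentationTheory.FiniteGroups (addableNodes IsAddableNode)

namespace Summit.MatrixMultiplication.MatrixMultiplication.Theorems

open PlancherelStep

set_option linter.dupNamespace false in
/-- In a lower set, the row of an addable node `(a, b)` consists of the cells `(a, j)`, `j < b`. -/
private theorem mem_row_iff_lt {ν : Finset (ℕ × ℕ)} (hν : IsLowerSet (ν : Set (ℕ × ℕ)))
    {a b : ℕ} (hy : IsAddableNode ν (a, b)) (j : ℕ) : (a, j) ∈ ν ↔ j < b := by
  obtain ⟨hy₀, -, hy₂⟩ := hy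
  dsimp only at hy₂
  refine ⟨fun h => ?_, fun hj => ?_⟩
  · by_contra hj
    exact hy₀ (Finset.mem_coe.1 (hν (Prod.mk_le_mk.2 ⟨le_rfl, not_lt.1 hj⟩) (Finset.mem_coe.2 h)))
  · exact Finset.mem_coe.1 (hν (Prod.mk_le_mk.2 ⟨le_rfl, show j ≤ b - 1 by omega⟩)
      (Finset.mem_coe.2 (hy₂.resolve_left (by omega))))

set_option linter.dupNamespace false in
/-- In a lower set, the column of an addable node `(a, b)` consists of the cells `(i, b)`, `i < a`. -/
private theorem mem_col_iff_lt {ν : Finset (ℕ × ℕ)} (hν : IsLowerSet (ν : Set (ℕ × ℕ)))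
    {a b : ℕ} (hy : IsAddableNode ν (a, b)) (i : ℕ) : (i, b) ∈ ν ↔ i < a := by
  obtain ⟨hy₀, hy₁, -⟩ := hy
  dsimp only at hy₁
  refine ⟨fun h => ?_, fun hi => ?_⟩
  · by_contra hi
    exact hy₀ (Finset.mem_coe.1 (hν (Prod.mk_le_mk.2 ⟨not_lt.1 hi, le_rfl⟩) (Finset.mem_coe.2 h)))
  · exact Finset.mem_coe.1 (hν (Prod.mk_le_mk.2 ⟨show i ≤ a - 1 by omega, le_rfl⟩)
      (Finset.mem_coe.2 (hy₁.resolve_left (by omega))))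

set_option linter.dupNamespace false in
/-- The row of an addable node `(a, b)` of a lower set has length `b`. -/
private theorem rowLen_eq_of_addable {ν : Finset (ℕ × ℕ)} (hν : IsLowerSet (ν : Set (ℕ × ℕ)))
    {a b : ℕ} (hy : IsAddableNode ν (a, b)) : rowLen ν a = b := by
  have hs : ν.filter (fun x => x.1 = a) = (Finset.range b).image fun j => (a, j) := by
    ext ⟨i, j⟩
    simp only [Finset.mem_filter, Finset.mem_image, Finset.mem_range, Prod.mk.injEq]
    refine ⟨?_, ?_⟩
    · rintro ⟨h, rfl⟩
      exact ⟨j, (mem_row_iff_lt hν hy j).1 h, rfl, rfl⟩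
    · rintro ⟨k, hk, rfl, rfl⟩
      exact ⟨(mem_row_iff_lt hν hy k).2 hk, rfl⟩
  rw [rowLen, hs, Finset.card_image_of_injective _ (Prod.mk_right_injective a),
    Finset.card_range]

set_option linter.dupNamespace false in
/-- The column of an addable node `(a, b)` of a lower set has length `a`. -/
private theorem colLen_eq_of_addable {ν : Finset (ℕ × ℕ)} (hν : IsLowerSet (ν : Set (ℕ × ℕ)))
    {a b : ℕ} (hy : IsAddableNode ν (a, b)) : colLen ν b = a := by
  have hs : ν.filter (fun x => x.2 = b) = (Finset.range a).image fun i => (i, b) := by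
    ext ⟨i, j⟩
    simp only [Finset.mem_filter, Finset.mem_image, Finset.mem_range, Prod.mk.injEq]
    refine ⟨?_, ?_⟩
    · rintro ⟨h, rfl⟩
      exact ⟨i, (mem_col_iff_lt hν hy i).1 h, rfl, rfl⟩
    · rintro ⟨k, hk, rfl, rfl⟩
      exact ⟨(mem_col_iff_lt hν hy k).2 hk, rfl⟩
  rw [colLen, hs, Finset.card_image_of_injective _ (Prod.mk_left_injective b),
    Finset.card_range]

set_option linter.dupNamespace false in
/-- Inserting a new cell `(r, c)` lengthens row `r` by one. -/
private theorem rowLen_insert_self {ν : Finset (ℕ × ℕ)} {r c : ℕ} (hz : (r, c) ∉ ν) :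
    rowLen (insert (r, c) ν) r = rowLen ν r + 1 := by
  rw [rowLen, rowLen, Finset.filter_insert, if_pos rfl, Finset.card_insert_of_notMem]
  exact fun h => hz (Finset.mem_filter.1 h).1

set_option linter.dupNamespace false in
/-- Inserting a cell `(r, c)` does not change the rows `i ≠ r`. -/
private theorem rowLen_insert_of_ne {ν : Finset (ℕ × ℕ)} {r c i : ℕ} (h : r ≠ i) :
    rowLen (insert (r, c) ν) i = rowLen ν i := by
  rw [rowLen, rowLen, Finset.filter_insert, if_neg h]

set_option linter.dupNamespace false in
/-- Inserting a new cell `(r, c)` lengthens column `c` by one. -/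
private theorem colLen_insert_self {ν : Finset (ℕ × ℕ)} {r c : ℕ} (hz : (r, c) ∉ ν) :
    colLen (insert (r, c) ν) c = colLen ν c + 1 := by
  rw [colLen, colLen, Finset.filter_insert, if_pos rfl, Finset.card_insert_of_notMem]
  exact fun h => hz (Finset.mem_filter.1 h).1

set_option linter.dupNamespace false in
/-- Inserting a cell `(r, c)` does not change the columns `j ≠ c`. -/
private theorem colLen_insert_of_ne {ν : Finset (ℕ × ℕ)} {r c j : ℕ} (h : c ≠ j) :
    colLen (insert (r, c) ν) j = colLen ν j := by
  rw [colLen, colLen, Finset.filter_insert, if_neg h]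

set_option linter.dupNamespace false in
/-- Inserting a cell in another row and another column does not change the hook of `(i, j)`. -/
private theorem hook_insert_of_ne {ν : Finset (ℕ × ℕ)} {r c i j : ℕ} (hi : r ≠ i) (hj : c ≠ j) :
    hook (insert (r, c) ν) (i, j) = hook ν (i, j) := by
  simp only [hook, rowLen_insert_of_ne hi, colLen_insert_of_ne hj]

set_option linter.dupNamespace false in
/-- The scalar identity behind (F3): when a hook `h = m + 1 ≥ 1` grows by one, the hook factor
`h/(h+1)` gets multiplied by `((h+1)/(h+2)) / (h/(h+1)) = 1 + 1/(h(h+2))`. -/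
private theorem succ_hookFactor_eq (m : ℕ) :
    ((m + 1 + 1 : ℕ) : ℝ) / ((m + 1 + 1 : ℕ) + 1) =
      ((m + 1 : ℕ) : ℝ) / ((m + 1 : ℕ) + 1) *
        (1 + 1 / (((m + 1 : ℕ) : ℝ) * (((m + 1 : ℕ) : ℝ) + 2))) := by
  push_cast
  field_simp
  ring

set_option linter.dupNamespace false in
/-- **(F3) The exact mass factor.** For a Young diagram `ν` (a finite lower set of cells) and two
distinct addable nodes `y ≠ z`, adding the corner `z` multiplies the Plancherel transition
probability of `y` by exactly `1 + 1/(h(h+2)) = (h+1)²/(h(h+2))`, where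
`h = |row y − row z| + |col y − col z| − 1 ≥ 1`: the two corners lie strictly north-east /
south-west of each other, and exactly one hook entering the hook-product form of `p_y` (the hook
of the cell in the row of the upper corner and the column of the lower one) grows, from `h` to
`h + 1`. [folklore] -/
theorem transProb_insert_of_ne : ∀ (ν : Finset (ℕ × ℕ)), IsLowerSet (ν : Set (ℕ × ℕ)) →
    ∀ (y z : ℕ × ℕ), y ∈ addableNodes ν → z ∈ addableNodes ν → y ≠ z →
      transProb (insert z ν) y = transProb ν y *
        (1 + 1 / (((Int.natAbs ((y.1 : ℤ) - z.1) + Int.natAbs ((y.2 : ℤ) - z.2) - 1 : ℕ) : ℝ) *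
          (((Int.natAbs ((y.1 : ℤ) - z.1) + Int.natAbs ((y.2 : ℤ) - z.2) - 1 : ℕ) : ℝ) + 2))) := by
  rintro ν hν ⟨a, b⟩ ⟨r, c⟩ hy hz hne
  rw [Literature.RepresentationTheory.FiniteGroups.mem_addableNodes] at hy hz
  have hzν : ((r, c) : ℕ × ℕ) ∉ ν := hz.1
  have hRa : rowLen ν a = b := rowLen_eq_of_addable hν hy
  have hCb : colLen ν b = a := colLen_eq_of_addable hν hy
  have hRr : rowLen ν r = c := rowLen_eq_of_addable hν hz
  have hCc : colLen ν c = r := colLen_eq_of_addable hν hz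
  simp only [transProb]
  rcases lt_trichotomy a r with har | rfl | hra
  · -- `y` is strictly above `z`, hence strictly to its right; the growing hook is `h(a, c)`,
    -- a factor of the row product.
    have hcb : c < b := (mem_row_iff_lt hν hy c).1 (Finset.mem_coe.1
      (hν (Prod.mk_le_mk.2 ⟨show a ≤ r - 1 by omega, le_rfl⟩)
        (Finset.mem_coe.2 (hz.2.1.resolve_left (show r ≠ 0 by omega)))))
    obtain ⟨m, hm⟩ : ∃ m : ℕ, r - a + (b - c) = m + 2 := ⟨r - a + (b - c) - 2, by omega⟩
    have hh : Int.natAbs ((a : ℤ) - r) + Int.natAbs ((b : ℤ) - c) - 1 = m + 1 := by omega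
    have hk : hook ν (a, c) = m + 1 := by
      simp only [hook, hRa, hCc]
      omega
    have hk' : hook (insert (r, c) ν) (a, c) = m + 1 + 1 := by
      simp only [hook, rowLen_insert_of_ne har.ne', colLen_insert_self hzν, hRa, hCc]
      omega
    have e₁ : ∏ j ∈ (Finset.range b).erase c,
          ((hook (insert (r, c) ν) (a, j) : ℝ) / (hook (insert (r, c) ν) (a, j) + 1)) =
        ∏ j ∈ (Finset.range b).erase c, ((hook ν (a, j) : ℝ) / (hook ν (a, j) + 1)) :=
      Finset.prod_congr rfl fun j hj => by
        rw [hook_insert_of_ne har.ne' (Finset.ne_of_mem_erase hj).symm]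
    have e₂ : ∏ i ∈ Finset.range a,
          ((hook (insert (r, c) ν) (i, b) : ℝ) / (hook (insert (r, c) ν) (i, b) + 1)) =
        ∏ i ∈ Finset.range a, ((hook ν (i, b) : ℝ) / (hook ν (i, b) + 1)) :=
      Finset.prod_congr rfl fun i hi => by
        rw [hook_insert_of_ne (show r ≠ i by have := Finset.mem_range.1 hi; omega) hcb.ne]
    rw [← Finset.mul_prod_erase _ _ (Finset.mem_range.2 hcb),
      ← Finset.mul_prod_erase _ _ (Finset.mem_range.2 hcb), e₁, e₂, hk, hk', hh,
      succ_hookFactor_eq]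
    ring
  · exact (hne (Prod.ext rfl (hRa.symm.trans hRr))).elim
  · -- `y` is strictly below `z`, hence strictly to its left; the growing hook is `h(r, b)`,
    -- a factor of the column product.
    have hbc : b < c := (mem_row_iff_lt hν hz b).1 (Finset.mem_coe.1
      (hν (Prod.mk_le_mk.2 ⟨show r ≤ a - 1 by omega, le_rfl⟩)
        (Finset.mem_coe.2 (hy.2.1.resolve_left (show a ≠ 0 by omega)))))
    obtain ⟨m, hm⟩ : ∃ m : ℕ, a - r + (c - b) = m + 2 := ⟨a - r + (c - b) - 2, by omega⟩
    have hh : Int.natAbs ((a : ℤ) - r) + Int.natAbs ((b : ℤ) - c) - 1 = m + 1 := by omega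
    have hk : hook ν (r, b) = m + 1 := by
      simp only [hook, hRr, hCb]
      omega
    have hk' : hook (insert (r, c) ν) (r, b) = m + 1 + 1 := by
      simp only [hook, rowLen_insert_self hzν, colLen_insert_of_ne hbc.ne', hRr, hCb]
      omega
    have e₁ : ∏ j ∈ Finset.range b,
          ((hook (insert (r, c) ν) (a, j) : ℝ) / (hook (insert (r, c) ν) (a, j) + 1)) =
        ∏ j ∈ Finset.range b, ((hook ν (a, j) : ℝ) / (hook ν (a, j) + 1)) :=
      Finset.prod_congr rfl fun j hj => by
        rw [hook_insert_of_ne hra.ne (show c ≠ j by have := Finset.mem_range.1 hj; omega)]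
    have e₂ : ∏ i ∈ (Finset.range a).erase r,
          ((hook (insert (r, c) ν) (i, b) : ℝ) / (hook (insert (r, c) ν) (i, b) + 1)) =
        ∏ i ∈ (Finset.range a).erase r, ((hook ν (i, b) : ℝ) / (hook ν (i, b) + 1)) :=
      Finset.prod_congr rfl fun i hi => by
        rw [hook_insert_of_ne (Finset.ne_of_mem_erase hi).symm hbc.ne']
    rw [← Finset.mul_prod_erase _ _ (Finset.mem_range.2 hra),
      ← Finset.mul_prod_erase _ _ (Finset.mem_range.2 hra), e₁, e₂, hk, hk', hh,
      succ_hookFactor_eq]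
    ring

end Summit.MatrixMultiplication.MatrixMultiplication.Theorems
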